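import Literature.NumberTheory.Transcendental.BakerLogarithmsConclusion

/-!
# Crux `LiouvilleUnfolding.LogPrimitiveNL` (stmt-KontsevichZagierPeriods-2836): Baker in relation-span form

Support for the picked line `logderiv-peeling` of the crux (its `stub_constRigidity`, second conjunct,
and `stub_descent`), from the standing disprover's work file
`Cruxes/LogPrimitiveNL/Disproof.lean` §12. From Baker's theorem as PROVED in the tree
(`Literature.NumberTheory.Transcendental.baker_holds`, Baker 1975 Thm. 2.1: `ℚ`-independent logarithms
of algebraic numbers are `ℚ̄`-independent together with `1`):

* `baker_relation_span_rat` — every relation `Σ cᵢ lᵢ = 0` with ALGEBRAIC coefficients `cᵢ` among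
  logarithms `lᵢ` of algebraic numbers (`e^{lᵢ} ∈ ℚ̄`) is a `ℚ̄`-linear combination of RATIONAL
  relations (`Σ mᵢ lᵢ = 0`, `m ∈ ℚᵏ`). Induction on `k`: if the `lᵢ` are `ℚ`-independent, Baker kills
  every `cᵢ`; otherwise a rational relation with `m_{i₀} ≠ 0` eliminates `l_{i₀}` and the induction
  hypothesis applies to the remaining `k − 1` logarithms with the modified (still algebraic)
  coefficients; the relations found extend by `0` at `i₀`, plus `m` itself.
* `baker_relation_span_int` — the same with INTEGER relation vectors (`exists_nat_mul_eq_intCast`,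
  clearing denominators), i.e. in the format of the line's `stub_constRigidity`:
  `∃ R (f : Fin R → Fin k → ℤ) (β : Fin R → ℂ), (∀ r, IsAlgebraic ℚ (β r)) ∧ (∀ r, Σ fᵣᵢ lᵢ = 0) ∧
  ∀ i, cᵢ = Σ βᵣ fᵣᵢ` (and `Σ fᵣᵢ lᵢ = 0` gives `∏ (e^{lᵢ})^{fᵣᵢ} = 1`).
What the stub still needs on top: the passage from relations among the NUMBERS `Wᵢ(q)` at rational
points `q` to relations EXACT on the open set `D` (intersection of the relation lattices over the
rational points of `D` = the exact lattice, by continuity and density; base change `ℚ → ℚ̄` commutes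
with finite intersections of `ℚ`-subspaces).
-/

noncomputable section

open Complex IntermediateField

namespace Summit.KontsevichZagierPeriods.LiouvilleUnfolding.LogPrimitiveNL.Negative

open Literature.NumberTheory.Transcendental

/-- **Baker, relation-span form** (rational relation vectors): every `ℚ̄`-linear relation
`Σ cᵢ lᵢ = 0` among logarithms `lᵢ` of algebraic numbers is a `ℚ̄`-combination of ℚ-linear relations. -/
theorem baker_relation_span_rat :
    ∀ (k : ℕ) (l c : Fin k → ℂ), (∀ i, IsAlgebraic ℚ (cexp (l i))) → (∀ i, IsAlgebraic ℚ (c i)) →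
      ∑ i, c i * l i = 0 →
      ∃ (R : ℕ) (m : Fin R → Fin k → ℚ) (β : Fin R → ℂ), (∀ r, IsAlgebraic ℚ (β r)) ∧
        (∀ r, ∑ i, (m r i : ℂ) * l i = 0) ∧ ∀ i, c i = ∑ r, β r * (m r i : ℂ) := by
  intro k
  induction k with
  | zero =>
    intro l c _ _ _
    exact ⟨0, Fin.elim0, Fin.elim0, fun r => r.elim0, fun r => r.elim0, fun i => i.elim0⟩
  | succ k ih =>
    intro l c halg hc hrel
    classical
    by_cases hli : LinearIndependent ℚ l
    · -- Baker: all coefficients vanish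
      have hB := baker_holds l halg hli
      set K := algebraicClosure ℚ ℂ
      have hzero : ∀ i, c i = 0 := by
        set g : Option (Fin (k + 1)) → K := fun o => o.elim 0 fun i => ⟨c i, mem_algebraicClosure_iff.mpr (hc i)⟩ with hg
        have hsum : ∑ o, g o • (o.elim (1 : ℂ) l) = 0 := by
          rw [Fintype.sum_option]
          simp only [hg, Option.elim_none, Option.elim_some, zero_smul, zero_add]
          simpa [IntermediateField.smul_def] using hrel
        have h0 := Fintype.linearIndependent_iff.mp hB g hsum
        intro i
        have := h0 (some i)
        simpa [hg, Subtype.ext_iff] using this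
      refine ⟨0, Fin.elim0, Fin.elim0, fun r => r.elim0, fun r => r.elim0, fun i => ?_⟩
      simp [hzero i]
    · -- a rational relation with a non-zero coefficient at `i₀`
      obtain ⟨a, ha, i₀, hi₀⟩ := Fintype.not_linearIndependent_iff.mp hli
      have ha' : ∑ i, (a i : ℂ) * l i = 0 := by
        simpa [Rat.smul_def] using ha
      -- eliminate `l i₀`
      set l' : Fin k → ℂ := fun j => l (i₀.succAbove j) with hl'
      set c' : Fin k → ℂ := fun j => c (i₀.succAbove j) - c i₀ * ((a (i₀.succAbove j) : ℂ) / a i₀)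
        with hc'
      have ha0 : (a i₀ : ℂ) ≠ 0 := by exact_mod_cast hi₀
      have hli₀ : l i₀ = -(∑ j, (a (i₀.succAbove j) : ℂ) * l' j) / a i₀ := by
        rw [Fin.sum_univ_succAbove _ i₀] at ha'
        rw [eq_div_iff ha0]
        linear_combination ha'
      have hrel' : ∑ j, c' j * l' j = 0 := by
        rw [Fin.sum_univ_succAbove _ i₀, hli₀] at hrel
        have e : ∑ j, c' j * l' j =
            ∑ j, c (i₀.succAbove j) * l (i₀.succAbove j) -
              c i₀ / a i₀ * ∑ j, (a (i₀.succAbove j) : ℂ) * l' j := by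
          simp only [hc', hl', sub_mul, Finset.sum_sub_distrib, Finset.mul_sum]
          congr 1
          exact Finset.sum_congr rfl fun j _ => by ring
        rw [e]
        have : c i₀ * (-(∑ j, (a (i₀.succAbove j) : ℂ) * l' j) / (a i₀ : ℂ)) =
            -(c i₀ / a i₀ * ∑ j, (a (i₀.succAbove j) : ℂ) * l' j) := by ring
        rw [this] at hrel
        linear_combination hrel
      have halg' : ∀ j, IsAlgebraic ℚ (cexp (l' j)) := fun j => halg _
      have hc'alg : ∀ j, IsAlgebraic ℚ (c' j) := fun j =>
        (hc _).sub ((hc _).mul ((isAlgebraic_algebraMap (a (i₀.succAbove j))).mul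
          (isAlgebraic_algebraMap (a i₀)).inv))
      obtain ⟨R', m', β', hβ', hm', hcm'⟩ := ih l' c' halg' hc'alg hrel'
      -- assemble: the old relations extended by `0` at `i₀`, plus `a` itself
      refine ⟨R' + 1, Fin.snoc (fun r => Fin.insertNth i₀ 0 (m' r)) a,
        Fin.snoc β' (c i₀ / a i₀), ?_, ?_, ?_⟩
      · intro r
        refine Fin.lastCases ?_ (fun r' => ?_) r
        · simp only [Fin.snoc_last]
          rw [div_eq_mul_inv]
          exact (hc i₀).mul (isAlgebraic_algebraMap (a i₀)).inv
        · simpa using hβ' r'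
      · intro r
        refine Fin.lastCases ?_ (fun r' => ?_) r
        · simpa using ha'
        · simp only [Fin.snoc_castSucc]
          rw [Fin.sum_univ_succAbove _ i₀, Fin.insertNth_apply_same]
          simp only [Fin.insertNth_apply_succAbove, Rat.cast_zero, zero_mul, zero_add]
          exact hm' r'
      · intro i
        rw [Fin.sum_univ_castSucc]
        simp only [Fin.snoc_castSucc, Fin.snoc_last]
        rcases Fin.eq_self_or_eq_succAbove i₀ i with rfl | ⟨j, rfl⟩
        · simp only [Fin.insertNth_apply_same, Rat.cast_zero, mul_zero, Finset.sum_const_zero, zero_add]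
          field_simp
        · simp only [Fin.insertNth_apply_succAbove]
          have := hcm' j
          simp only [hc'] at this
          rw [← this]
          field_simp
          ring

/-- Clearing denominators: a rational vector is an integer vector divided by a positive integer. -/
theorem exists_nat_mul_eq_intCast {k : ℕ} (q : Fin k → ℚ) :
    ∃ (N : ℕ) (m : Fin k → ℤ), 0 < N ∧ ∀ i, (N : ℚ) * q i = m i := by
  classical
  refine ⟨∏ j, (q j).den, fun i => ((∏ j, (q j).den) / (q i).den : ℕ) * (q i).num, ?_, fun i => ?_⟩
  · exact Finset.prod_pos fun j _ => (q j).den_pos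
  · have hdvd : (q i).den ∣ ∏ j, (q j).den := Finset.dvd_prod_of_mem _ (Finset.mem_univ i)
    have hden : ((q i).den : ℚ) ≠ 0 := by exact_mod_cast (q i).den_ne_zero
    have e1 : ((∏ j, (q j).den : ℕ) : ℚ) = (((∏ j, (q j).den) / (q i).den : ℕ) : ℚ) * (q i).den := by
      rw [← Nat.cast_mul, Nat.div_mul_cancel hdvd]
    rw [e1, mul_assoc, mul_comm ((q i).den : ℚ) (q i), Rat.mul_den_eq_num]
    simp only [Int.cast_mul, Int.cast_natCast]

/-- **Baker, relation-span form, integer relations**: every `ℚ̄`-linear relation `Σ cᵢ lᵢ = 0` among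
logarithms of algebraic numbers is a `ℚ̄`-combination of INTEGER relations `Σ mᵢ lᵢ = 0`, `m ∈ ℤᵏ`
(so that `∏ (e^{lᵢ})^{mᵢ} = 1`). -/
theorem baker_relation_span_int {k : ℕ} (l c : Fin k → ℂ) (halg : ∀ i, IsAlgebraic ℚ (cexp (l i)))
    (hc : ∀ i, IsAlgebraic ℚ (c i)) (hrel : ∑ i, c i * l i = 0) :
    ∃ (R : ℕ) (m : Fin R → Fin k → ℤ) (β : Fin R → ℂ), (∀ r, IsAlgebraic ℚ (β r)) ∧
      (∀ r, ∑ i, (m r i : ℂ) * l i = 0) ∧ ∀ i, c i = ∑ r, β r * (m r i : ℂ) := by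
  obtain ⟨R, mq, β, hβ, hmq, hcq⟩ := baker_relation_span_rat k l c halg hc hrel
  choose N m hN hNm using fun r => exists_nat_mul_eq_intCast (mq r)
  refine ⟨R, m, fun r => β r / N r, fun r => ?_, fun r => ?_, fun i => ?_⟩
  · show IsAlgebraic ℚ (β r / (N r : ℂ))
    rw [div_eq_mul_inv]
    exact (hβ r).mul (isAlgebraic_nat (N r)).inv
  · have e : ∀ i, (m r i : ℂ) = (N r : ℂ) * (mq r i : ℂ) := fun i => by
      have := hNm r i
      have : ((m r i : ℚ) : ℂ) = (((N r : ℚ) * mq r i : ℚ) : ℂ) := by rw [this]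
      push_cast at this
      exact this
    simp_rw [e, mul_assoc, ← Finset.mul_sum, hmq r, mul_zero]
  · rw [hcq i]
    refine Finset.sum_congr rfl fun r _ => ?_
    have hN0 : (N r : ℂ) ≠ 0 := by exact_mod_cast (hN r).ne'
    have e : (m r i : ℂ) = (N r : ℂ) * (mq r i : ℂ) := by
      have := hNm r i
      have : ((m r i : ℚ) : ℂ) = (((N r : ℚ) * mq r i : ℚ) : ℂ) := by rw [this]
      push_cast at this
      exact this
    rw [e]
    field_simp


end Summit.KontsevichZagierPeriods.LiouvilleUnfolding.LogPrimitiveNL.Negative
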